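import Summits.BirchSwinnertonDyer.BirchSwinnertonDyer.Theorems.SchneiderFreeAdditiveX3LineCharacterBaseChange
import Summits.BirchSwinnertonDyer.BirchSwinnertonDyer.Theorems.SchneiderFreeAdditiveX3LocalTowerTorsionFiniteOfFacts
import Summits.BirchSwinnertonDyer.BirchSwinnertonDyer.Theorems.SchneiderFreeAdditiveX3AnticycControlAdditiveKFOfRegimes
import Summits.BirchSwinnertonDyer.BirchSwinnertonDyer.Theorems.SchneiderFreeAdditiveX3ControlGlobalPTorsionF
import Literature.NumberTheory.EllipticCurves.TateCurve.NumberFieldUniformizationTwisted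
import HarnessLib

/-!
# The control corner's two F-records from ONE `ℚ`-side statement
# (items stmt-BirchSwinnertonDyer-19668 `LocalTowerTorsionFiniteX3F` and -19669 `AnticycControlAdditiveKFF`)

Seat `bsd-schneider-door-c4` (cell `bsd-schneider-ideate`), gen 5; route `SchneiderFreeAdditiveX3`
(rev 14).  After door-c2 gen 5 (the (M) cell modulo the PROVED Tate uniformisation A41, p452324) and
this seat's FILE 3 (`…LineCharacterBaseChange`: the line with character passes from `(ℚ̄, D_v)` to
`(K̄, D_𝔭)` at a split prime), BOTH F-typed records of the control corner —

* `LocalTowerTorsionFiniteX3F` = (LCFT fact p443291) → Fin_v on the door's frames (item 19668), and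
* `AnticycControlAdditiveKFF` = (LCFT fact) → the anticyclotomic control EQUALITY (item 19669) —

follow from ONE statement about `E/ℚ` AT THE PLACE `v ∋ p` OF `ℚ`: on the cell (G-ord, `e = 2`),
`E[p^∞](ℚ̄)` carries a `D_v`-stable line with one cyclic layer and points of every order, an element of
`D_v` acting as `−1` modulo it, and the character `± ε · α^{−n}` on Frobenius-degree-`n` elements of
`Γ_{ℚ_v}` (`α² = aα − p`) — hypothesis `hLineQ` below (Greenberg's reduction line of the good ordinary
`p*`-twist with its unit-root character, twisted: FILES 1–2 of the hLine plan, door-c6 gen 3 /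
door-c5 gen 6).  The hour `hLineQ` is a theorem `T`, the items close BY NAME with
`localTowerTorsionFiniteX3F_of_lineCharacterRat T` (`--workitem …-19668`) and
`anticycControlAdditiveKFF_of_lineCharacterRat T` (`--workitem …-19669`).

* `localTowerTorsionFiniteX3_of_CFT_of_lineCharacterRat` — crux r5's statement from (i) the LCFT fact
  and (ii-ℚ) `hLineQ` (door-c2's `localTowerTorsionFiniteX3_of_facts_of_lineCharacter_gordTwo` with A41
  discharged by `Silverman1994_thmV53_corV54_tateUniformisation_holds` and the (G-ord) hypothesis
  transported by `hLine_gordTwo_of_rat`);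
* `localTowerTorsionFiniteX3F_of_lineCharacterRat : hLineQ → LocalTowerTorsionFiniteX3F`;
* `anticycControlAdditiveKFF_of_lineCharacterRat : hLineQ → AnticycControlAdditiveKFF` (door-c4 gen 3's
  `anticycControlAdditiveKF_of_finV_of_regimeB2` + `controlGlobalPTorsionF_holds`).

Proofs only (no definition, no named fact, no `sorry`); CONDITIONAL on `hLineQ`; helper for the two
records; closes none of B6's cells by itself (the corner is the exact-count RECORD, off the leaf's
critical path since p447721); BSD is not advanced.  References: [JetchevSkinnerWan2017] §3.3
Prop. 3.3.1, Thm. 3.3.3, Prop. 3.3.4 Case 3(b); [GreenbergLNM1716] §2–3.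
-/

noncomputable section

open scoped Classical

namespace Summit.BirchSwinnertonDyer.BirchSwinnertonDyer.Theorems.SchneiderFreeAdditiveX3

open NumberField IsDedekindDomain Field WeierstrassCurve
  Literature.NumberTheory.EllipticCurves Literature.NumberTheory.EllipticCurves.GreenbergSelmer
  Literature.NumberTheory.GaloisRepresentations
  Summit.BirchSwinnertonDyer.Rank1Residual.X11b
  Summit.BirchSwinnertonDyer.BirchSwinnertonDyer.Theses.SchneiderFreeAdditiveX3

set_option linter.dupNamespace false

/-- **Crux r5 `LocalTowerTorsionFiniteX3` from (i) the LCFT fact and (ii-ℚ) the line with character of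
the cell (G-ord, `e = 2`) at the place of `ℚ`.**  (M) cell: door-c2 gen 5, modulo the Tate
uniformisation A41, which is PROVED in the tree (`Silverman1994_thmV53_corV54_tateUniformisation_holds`)
and discharged here; (G-ord) cell: `hLineQ` transported to `(K, 𝔭)` by `hLine_gordTwo_of_rat` (FILE 3).
CONDITIONAL on `hLineQ`. [cite: JetchevSkinnerWan2017, §3.3 Prop. 3.3.4 Case 3(b), Remark 3.3.5 (arXiv:1512.06894 p. 13)] -/
theorem localTowerTorsionFiniteX3_of_CFT_of_lineCharacterRat
    (hCFT : ∀ (K : Type) [Field K] [NumberField K] (p : ℕ) [Fact p.Prime],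
      ZpExtension.exists_isFrobPow_mem_kerSubgroup_of_isAnticyclotomic K p)
    (hLineQ : ∀ (W : WeierstrassCurve ℚ) [W.IsElliptic] [W.IsGloballyMinimal] (p : ℕ) [Fact p.Prime],
      W.analyticRank = 1 → p ≠ 2 → Literature.NumberTheory.EllipticCurves.Rank1Residual.ClassX3 W p →
        Summit.BirchSwinnertonDyer.Rank1Residual.Additive.SubGordTwo W p →
        ∀ (v : HeightOneSpectrum (𝓞 ℚ)), ((p : ℕ) : 𝓞 ℚ) ∈ v.asIdeal →
          ∃ (C : AddSubgroup (W.geomPrimaryTorsion p)) (a : ℤ) (α : ℤ_[p]ˣ),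
            (∀ d ∈ decomp v, ∀ c ∈ C, d • c ∈ C) ∧
            Set.ncard {c : W.geomPrimaryTorsion p | c ∈ C ∧ p • c = 0} ≤ p ∧
            (∀ k : ℕ, ∃ c ∈ C, addOrderOf c = p ^ k) ∧
            (∃ τ ∈ decomp v, ∀ m : W.geomPrimaryTorsion p, τ • m + m ∈ C) ∧
            ((α : ℤ_[p])) ^ 2 = a * (α : ℤ_[p]) - p ∧
            (∀ (σ : absoluteGaloisGroup (v.adicCompletion ℚ)) (n : ℕ), IsFrobPow σ (n : ℤ) →
              ∃ s : ℤ, (s = 1 ∨ s = -1) ∧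
                ∀ (k : ℕ) (c : W.geomPrimaryTorsion p), c ∈ C → p ^ k • c = 0 →
                  ∀ N : ℤ, ((N : ℤ_[p]) - s *
                      ((GaloisRep.cyclotomicCharacter ℚ p
                          (absGaloisRestrict ℚ (v.adicCompletion ℚ) σ) * (α⁻¹) ^ n : ℤ_[p]ˣ) :
                        ℤ_[p]) ∈ (Ideal.span {(p : ℤ_[p]) ^ k} : Ideal ℤ_[p])) →
                    absGaloisRestrict ℚ (v.adicCompletion ℚ) σ • c = N • c)) :
    LocalTowerTorsionFiniteX3 :=
  localTowerTorsionFiniteX3_of_facts_of_lineCharacter_gordTwo hCFT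
    Literature.NumberTheory.EllipticCurves.TateCurve.Silverman1994_thmV53_corV54_tateUniformisation_holds
    (hLine_gordTwo_of_rat hLineQ)

/-- **Item stmt-BirchSwinnertonDyer-19668 `LocalTowerTorsionFiniteX3F` from the `ℚ`-side line with
character** (`hLineQ` as above): `fun hCFT ↦ localTowerTorsionFiniteX3_of_CFT_of_lineCharacterRat hCFT hLineQ`.
CONDITIONAL on `hLineQ`; the by-name closer once `hLineQ` is a theorem.
[cite: JetchevSkinnerWan2017, §3.3 Prop. 3.3.4 Case 3(b), Remark 3.3.5 (arXiv:1512.06894 p. 13)] -/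
theorem localTowerTorsionFiniteX3F_of_lineCharacterRat
    (hLineQ : ∀ (W : WeierstrassCurve ℚ) [W.IsElliptic] [W.IsGloballyMinimal] (p : ℕ) [Fact p.Prime],
      W.analyticRank = 1 → p ≠ 2 → Literature.NumberTheory.EllipticCurves.Rank1Residual.ClassX3 W p →
        Summit.BirchSwinnertonDyer.Rank1Residual.Additive.SubGordTwo W p →
        ∀ (v : HeightOneSpectrum (𝓞 ℚ)), ((p : ℕ) : 𝓞 ℚ) ∈ v.asIdeal →
          ∃ (C : AddSubgroup (W.geomPrimaryTorsion p)) (a : ℤ) (α : ℤ_[p]ˣ),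
            (∀ d ∈ decomp v, ∀ c ∈ C, d • c ∈ C) ∧
            Set.ncard {c : W.geomPrimaryTorsion p | c ∈ C ∧ p • c = 0} ≤ p ∧
            (∀ k : ℕ, ∃ c ∈ C, addOrderOf c = p ^ k) ∧
            (∃ τ ∈ decomp v, ∀ m : W.geomPrimaryTorsion p, τ • m + m ∈ C) ∧
            ((α : ℤ_[p])) ^ 2 = a * (α : ℤ_[p]) - p ∧
            (∀ (σ : absoluteGaloisGroup (v.adicCompletion ℚ)) (n : ℕ), IsFrobPow σ (n : ℤ) →
              ∃ s : ℤ, (s = 1 ∨ s = -1) ∧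
                ∀ (k : ℕ) (c : W.geomPrimaryTorsion p), c ∈ C → p ^ k • c = 0 →
                  ∀ N : ℤ, ((N : ℤ_[p]) - s *
                      ((GaloisRep.cyclotomicCharacter ℚ p
                          (absGaloisRestrict ℚ (v.adicCompletion ℚ) σ) * (α⁻¹) ^ n : ℤ_[p]ˣ) :
                        ℤ_[p]) ∈ (Ideal.span {(p : ℤ_[p]) ^ k} : Ideal ℤ_[p])) →
                    absGaloisRestrict ℚ (v.adicCompletion ℚ) σ • c = N • c)) :
    LocalTowerTorsionFiniteX3F :=
  fun hCFT ↦ localTowerTorsionFiniteX3_of_CFT_of_lineCharacterRat hCFT hLineQ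

/-- **Item stmt-BirchSwinnertonDyer-19669 `AnticycControlAdditiveKFF` from the `ℚ`-side line with
character**: Fin_v (previous theorem) + regime B2 (`controlGlobalPTorsionF_holds`, door-c4 gen 3) fed to
`anticycControlAdditiveKF_of_finV_of_regimeB2` (regimes A / B1 closed inside).  CONDITIONAL on
`hLineQ`; the by-name closer once `hLineQ` is a theorem.
[cite: JetchevSkinnerWan2017, §3.3 Prop. 3.3.1 and Thm. 3.3.3 (arXiv:1512.06894)] -/
theorem anticycControlAdditiveKFF_of_lineCharacterRat
    (hLineQ : ∀ (W : WeierstrassCurve ℚ) [W.IsElliptic] [W.IsGloballyMinimal] (p : ℕ) [Fact p.Prime],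
      W.analyticRank = 1 → p ≠ 2 → Literature.NumberTheory.EllipticCurves.Rank1Residual.ClassX3 W p →
        Summit.BirchSwinnertonDyer.Rank1Residual.Additive.SubGordTwo W p →
        ∀ (v : HeightOneSpectrum (𝓞 ℚ)), ((p : ℕ) : 𝓞 ℚ) ∈ v.asIdeal →
          ∃ (C : AddSubgroup (W.geomPrimaryTorsion p)) (a : ℤ) (α : ℤ_[p]ˣ),
            (∀ d ∈ decomp v, ∀ c ∈ C, d • c ∈ C) ∧
            Set.ncard {c : W.geomPrimaryTorsion p | c ∈ C ∧ p • c = 0} ≤ p ∧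
            (∀ k : ℕ, ∃ c ∈ C, addOrderOf c = p ^ k) ∧
            (∃ τ ∈ decomp v, ∀ m : W.geomPrimaryTorsion p, τ • m + m ∈ C) ∧
            ((α : ℤ_[p])) ^ 2 = a * (α : ℤ_[p]) - p ∧
            (∀ (σ : absoluteGaloisGroup (v.adicCompletion ℚ)) (n : ℕ), IsFrobPow σ (n : ℤ) →
              ∃ s : ℤ, (s = 1 ∨ s = -1) ∧
                ∀ (k : ℕ) (c : W.geomPrimaryTorsion p), c ∈ C → p ^ k • c = 0 →
                  ∀ N : ℤ, ((N : ℤ_[p]) - s *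
                      ((GaloisRep.cyclotomicCharacter ℚ p
                          (absGaloisRestrict ℚ (v.adicCompletion ℚ) σ) * (α⁻¹) ^ n : ℤ_[p]ˣ) :
                        ℤ_[p]) ∈ (Ideal.span {(p : ℤ_[p]) ^ k} : Ideal ℤ_[p])) →
                    absGaloisRestrict ℚ (v.adicCompletion ℚ) σ • c = N • c)) :
    AnticycControlAdditiveKFF :=
  fun hCFT ↦ anticycControlAdditiveKF_of_finV_of_regimeB2
    (localTowerTorsionFiniteX3F_of_lineCharacterRat hLineQ hCFT) controlGlobalPTorsionF_holds

end Summit.BirchSwinnertonDyer.BirchSwinnertonDyer.Theorems.SchneiderFreeAdditiveX3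

end
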